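import Summits.CriticalPhenomena.PercolationContinuityZ3.Theorems.PercNearOneGluingNoHeavyQuantLSCoreMMGBreakpoints
import Summits.CriticalPhenomena.PercolationContinuityZ3.Theorems.PercNearOneGluingNoHeavyQuantLSCoreMMGEff
import Summits.CriticalPhenomena.PercolationContinuityZ3.Theorems.PercNearOneGluingNoHeavyQuantLSCoreFlow
import Summits.CriticalPhenomena.PercolationContinuityZ3.Theorems.PercNearOneGluingNoHeavyQuantTwoLowGreedy
import HarnessLib

/-!
# QUANT lane R8, T-DEC, binder (II) `ConvClosedTResidue`: **LS-CORE, PATTERN MMG IS A THEOREM** — the light slice of a Type-I atom by a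
# light straddling credit pair of span at most the atom's light span is DEC at the total target

builds on p205010 (kernel theorem, internal audit signed; external expert review pending)

Support file (`--supports stmt-CriticalPhenomena-4575`), QUANT lane seat prim-quant-census-1 (gen 22), rung R8 of
`run/shared/lean/prim/quant/LADDER.md`.  Memo `run/shared/lean/prim/quant/prim-quant-census-1/LSCORE-G22.md`.  Theorems only, standard
axioms, no sorries.

THE STATEMENT (`LawDec.lsCore_MMG_decAtT`).  In the top-datum architecture for the two-sided residue of `ConvClosedT` (census-1 g21,
`…QuantConvTopDatum`) the decomposed atom `ν_A` contributes its light straddling credit pair `c_A = {p, m; γ}`, `γ = x² + (1−x)ρ_c`, and the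
partner Type-I atom `ν_B` (lows `l < l′`, absorber `h` of mass `x`, tails `(1−x)λ, (1−x)(1−λ)`, light rate `ρ_l < x`, expensive rate
`ρ_e > x`, credit identity `λ(ρ_e − (x² + (1−x)ρ_l)) = (x−ρ_l)(1−ρ_e)`) is sliced by it: `L = (1−γ)·shift_p ν_B + γ·shift_m ν_B`, six cells.  In the
pattern MMG (`T ≤ 2(m+l)`: row `m` all absorbers; `T ≤ 2(p+h)`: the head cell of row `p` a mid — "¬A2"), in the deep straddling geometry
`p + h ≤ j < m + h ≤ M`, and at span ratio ≤ 1 (`m + l′ ≤ p + h`, the side the residue's selection rule picks), `L ∈ 𝒟(T, j)` at the total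
target `T = T_A + T_B = 2(p+l′) + ρ_l(h−l′) + ρ_c(m−p)`.  PROOF = the two-low greedy (`…QuantTwoLowGreedy`) in the universal Monge order of the
region, fed with the four breakpoint inequalities (`…QuantLSCoreMMGBreakpoints`, resting on the 15 polynomial cells `…Cells A–F` found as LP
certificates), and the six-cell flow lemma (`…QuantLSCoreFlow`).  What remains for the Type I ⊗ Type I residue: patterns LMG (3 lows) and LLG
(4 lows, 2 absorbers), the normal form of residue factors, the selection lemma and the assembly with `lconv_decAtT_of_window_pdecAtT`.

* **`LawDec.lsCore_MMG_decAtT`** — the theorem.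

HONEST: `ConvClosedTResidue`, `ConvClosedTSmall`, `ConvClosedT`, `SDECConvClosed`, `TreeBuiltDEC`, `TreeDEC`, `FarTreeRow` remain OPEN; RATE
class log\* / honest sentence unchanged.

[this work].  Nothing here is cited as a published result.  The gluing rows served [cite: KozmaNitzan2024, Conjecture 3 (p. 15)]; product
measure [cite: Grimmett1999, §1.3 p. 10].
-/

noncomputable section

namespace Summit.CriticalPhenomena.PercolationContinuityZ3.Theorems

namespace Quant

open Finset

namespace LawDec

open LSCoreMMG

set_option maxHeartbeats 20000000 in
/-- **LS-CORE, PATTERN MMG (Type I ⊗ Type I, span ratio ≤ 1).**  Floor `0 < x < 1`; the light straddling credit pair `c_A = {p, m; γ}`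
(`γ = x² + (1−x)ρ_c`, `0 < ρ_c < x`) of the decomposed atom slices the partner atom `ν_B` — lows `l < l′` with light rate `0 ≤ ρ_l < x` and
expensive rate `x < ρ_e < 1` (`ρ_e(h−l) = ρ_l(h−l′) + 2(l′−l)`: both credit pairs meet the same target), absorber `h` of mass `x`, tail weights
`(1−x)λ, (1−x)(1−λ)` fixed by the credit identity `λ(ρ_e − (x² + (1−x)ρ_l)) = (x − ρ_l)(1 − ρ_e)` — at the total target
`T = 2(p+l′) + ρ_l(h−l′) + ρ_c(m−p)`, in the geometry `m + l′ ≤ p + h ≤ j < m + h ≤ M` (span of `c_A` at most the span of `ν_B`'s light pair,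
deep head cell, straddling giant) and the pattern `T ≤ 2(m+l)`, `T ≤ 2(p+h)` (row `m` and the head cell are absorbers): the six-cell law
`(1−γ)·shift_p ν_B + γ·shift_m ν_B` is `DECAtT x T j M`.  Proof: the two-low greedy (`twoLow_greedy_flows`) fed with the four breakpoint
inequalities (`hkA/B/C/G_holds`, resting on the 15 polynomial cells of `…LSCoreMMGCells A–F`) and the flow lemma
`lsLaw_decAtT_of_flow`. [this work] -/
theorem lsCore_MMG_decAtT (x T ρc ρl ρe lam : ℝ) (p m l l' h j M : ℕ)
    (hx0 : 0 < x) (hx1 : x < 1) (hpm : p < m) (hll : l < l') (hlh : l' < h)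
    (hω : m + l' ≤ p + h) (hPj : p + h ≤ j) (hGj : j < m + h) (hGM : m + h ≤ M)
    (hρc0 : 0 < ρc) (hρcx : ρc < x) (hρl0 : 0 ≤ ρl) (hρlx : ρl < x) (hρex : x < ρe) (hρe1 : ρe < 1)
    (hTB : ρe * ((h : ℝ) - l) = ρl * ((h : ℝ) - l') + 2 * ((l' : ℝ) - l))
    (hT : T = 2 * ((p : ℝ) + l') + ρl * ((h : ℝ) - l') + ρc * ((m : ℝ) - p))
    (hlam0 : 0 ≤ lam) (hlam1 : lam ≤ 1)
    (hcredit : lam * (ρe - (x ^ 2 + (1 - x) * ρl)) = (x - ρl) * (1 - ρe))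
    (hA2 : T ≤ 2 * ((p : ℝ) + h)) (hM1 : T ≤ 2 * ((m : ℝ) + l)) :
    DECAtT x T j M (fun q => (1 - (x ^ 2 + (1 - x) * ρc)) * (1 - x) * lam * (if q = p + l then (1:ℝ) else 0)
      + (1 - (x ^ 2 + (1 - x) * ρc)) * (1 - x) * (1 - lam) * (if q = p + l' then (1:ℝ) else 0)
      + (1 - (x ^ 2 + (1 - x) * ρc)) * x * (if q = p + h then (1:ℝ) else 0)
      + (x ^ 2 + (1 - x) * ρc) * (1 - x) * lam * (if q = m + l then (1:ℝ) else 0)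
      + (x ^ 2 + (1 - x) * ρc) * (1 - x) * (1 - lam) * (if q = m + l' then (1:ℝ) else 0)
      + (x ^ 2 + (1 - x) * ρc) * x * (if q = m + h then (1:ℝ) else 0)) := by
  classical
  -- ### scale-free coordinates
  have he : (0 : ℝ) < (h : ℝ) - l' := by
    have : (l' : ℝ) < h := by exact_mod_cast hlh
    linarith
  obtain ⟨e, he_def⟩ : ∃ e : ℝ, e = (h : ℝ) - l' := ⟨_, rfl⟩
  rw [← he_def] at he
  set r : ℝ := ρl with hr_def
  obtain ⟨t, ht_def⟩ : ∃ t : ℝ, t = ((l' : ℝ) - l) / e := ⟨_, rfl⟩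
  obtain ⟨w, hw_def⟩ : ∃ w : ℝ, w = ((m : ℝ) - p) / e := ⟨_, rfl⟩
  obtain ⟨d, hd_def⟩ : ∃ d : ℝ, d = ρc * w := ⟨_, rfl⟩
  have hte : t * e = (l' : ℝ) - l := by rw [ht_def]; exact div_mul_cancel₀ _ he.ne'
  have hwe : w * e = (m : ℝ) - p := by rw [hw_def]; exact div_mul_cancel₀ _ he.ne'
  have ht0 : 0 < t := by
    rw [ht_def]; apply div_pos _ he
    have : (l : ℝ) < l' := by exact_mod_cast hll
    linarith
  have hw0 : 0 < w := by
    rw [hw_def]; apply div_pos _ he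
    have : (p : ℝ) < m := by exact_mod_cast hpm
    linarith
  have hw1 : w ≤ 1 := by
    rw [hw_def, div_le_one he]
    have : ((m : ℝ) + l') ≤ (p : ℝ) + h := by exact_mod_cast hω
    linarith
  have hd0 : 0 ≤ d := by rw [hd_def]; positivity
  have hdx : d < x * w := by rw [hd_def]; exact mul_lt_mul_of_pos_right hρcx hw0
  -- the expensive rate in terms of `t`
  have hρet : ρe * (1 + t) = r + 2 * t := by
    have h1 : ρe * ((h : ℝ) - l) = r * e + 2 * (t * e) := by rw [hTB, hte, he_def]
    have h2 : (h : ℝ) - l = e * (1 + t) := by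
      have : (h : ℝ) - l = e + ((l' : ℝ) - l) := by rw [he_def]; ring
      rw [this, ← hte]; ring
    rw [h2] at h1
    have h3 : e * (ρe * (1 + t)) = e * (r + 2 * t) := by linear_combination h1
    exact mul_left_cancel₀ he.ne' h3
  have ht1 : (0 : ℝ) < 1 + t := by linarith
  have hre : 0 < r - x + t * (2 - x) := by
    have := mul_lt_mul_of_pos_right hρex ht1
    linarith
  have hre1 : 0 < 1 - t - r := by
    have := mul_lt_mul_of_pos_right hρe1 ht1
    linarith
  -- the two deficits: `T − 2(p+l′) = e·(r + d)`, `T − 2(p+l) = e·(r + d + 2t)`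
  have hTA : T - 2 * ((p : ℝ) + l') = e * (r + d) := by
    rw [hT, hd_def, hr_def]; rw [show ρc * ((m : ℝ) - p) = ρc * (w * e) by rw [hwe], he_def]; ring
  have hTB' : T - 2 * ((p : ℝ) + l) = e * (r + d + 2 * t) := by
    have : T - 2 * ((p : ℝ) + l) = (T - 2 * ((p : ℝ) + l')) + 2 * ((l' : ℝ) - l) := by ring
    rw [this, hTA, ← hte]; ring
  have hA2' : r + d ≤ 2 := by
    have : e * (r + d) ≤ e * 2 := by rw [← hTA]; rw [he_def]; linarith
    exact le_of_mul_le_mul_left this he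
  have hM1' : r + d + 2 * t ≤ 2 * w := by
    have h1 : e * (r + d + 2 * t) ≤ 2 * ((m : ℝ) + l) - 2 * ((p : ℝ) + l) := by rw [← hTB']; linarith
    have h2 : 2 * ((m : ℝ) + l) - 2 * ((p : ℝ) + l) = e * (2 * w) := by rw [show e * (2 * w) = 2 * (w * e) by ring, hwe]; ring
    rw [h2] at h1
    exact le_of_mul_le_mul_left h1 he
  have hApos : 0 < r + d := by
    have : 0 < d := by rw [hd_def]; positivity
    linarith
  -- ### the tail weights in closed form
  have hD : 0 < t * (2 - x ^ 2 - (1 - x) * r) - x * (x - r) := LSCoreMMG.D_pos x r t hx0 hx1 hρl0 hρlx hre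
  have hlamD : lam * (t * (2 - x ^ 2 - (1 - x) * r) - x * (x - r)) = (x - r) * (1 - t - r) := by
    linear_combination (1 + t) * hcredit - (lam + (x - r)) * hρet
  have hlam_eq : (x - r) * (1 - t - r) / (t * (2 - x ^ 2 - (1 - x) * r) - x * (x - r)) = lam := by
    rw [div_eq_iff hD.ne', hlamD]
  have hlaml_eq : (1 + x - r) * (r - x + t * (2 - x)) / (t * (2 - x ^ 2 - (1 - x) * r) - x * (x - r)) = 1 - lam := by
    rw [div_eq_iff hD.ne']
    linear_combination hlamD
  have hgd : x ^ 2 + (1 - x) * d / w = x ^ 2 + (1 - x) * ρc := by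
    rw [hd_def, mul_div_assoc, mul_div_cancel_right₀ _ hw0.ne']
  -- ### masses
  set γ : ℝ := x ^ 2 + (1 - x) * ρc with hγ
  have hγ0 : 0 < γ := by positivity
  have hxx : x * x + (1 - x) * x = x := by ring
  have hsq : x ^ 2 = x * x := sq x
  have hγ1 : γ < 1 := by
    have := mul_lt_mul_of_pos_left hρcx (sub_pos.2 hx1)
    rw [hγ]; linarith
  -- ### efficiencies, exchange ratios (package)
  obtain ⟨e2P, e22, e21, e1P, e12, e11, κC, κB, κA, h2P_N, h2P_H, h2P_L, h22_N, h22_H, h22_L, h21_N, h21_H, h21_L, h1P_N, h1P_H, h12_N, h12_H, h11_N, h11_H, he2P0, he220, he210, he1P0, he120, he110, hκC_N, hκC_H, hκC_L, hκB_N, hκB_H, hκB_L, hκA_N, hκA_H, hκA_L, hκC0, hκB0, hκA0, hκCe, hκBe, hκAe⟩ :=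
    eff_package x r t d w hx0 hx1 ht0 hw0 hApos
  -- ### the four breakpoint inequalities (scale-free), rewritten in terms of `lam`, `γ`
  have hkG' := hkG_holds x r t d w e2P e22 e21 hx0 hx1 hρl0 hρlx ht0 hw0 hw1 hd0 hdx hre hre1 hA2' hM1'
    h2P_N h2P_H h2P_L h22_N h22_H h22_L h21_N h21_H h21_L
  have hkC' := hkC_holds x r t d w e2P e22 e21 κC hx0 hx1 hρl0 hρlx ht0 hw0 hw1 hd0 hdx hre hre1 hA2' hM1'
    h2P_N h2P_H h2P_L h22_N h22_H h22_L h21_N h21_H h21_L hκC_N hκC_H hκC_L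
  have hkB' := hkB_holds x r t d w e22 e21 e1P κB hx0 hx1 hρl0 hρlx ht0 hw0 hw1 hd0 hdx hre hre1 hA2' hM1'
    h22_N h22_H h22_L h21_N h21_H h21_L h1P_N h1P_H hκB_N hκB_H hκB_L
  have hkA' := hkA_holds x r t d w e21 e1P e12 κA hx0 hx1 hρl0 hρlx ht0 hw0 hw1 hd0 hdx hre hre1 hA2' hM1'
    h21_N h21_H h21_L h1P_N h1P_H h12_N h12_H hκA_N hκA_H hκA_L
  rw [hgd, hlam_eq, hlaml_eq] at hkG' hkC' hkB' hkA'
  -- ### usage of the six cross pairs in scaled coordinates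
  have hBpos : 0 < r + d + 2 * t := by linarith
  have hxB : x * (1 + t) ≤ r + d + 2 * t := by
    have := mul_lt_mul_of_pos_right hρex ht1
    linarith
  have hΔC2 : T - 2 * ((p + l' : ℕ) : ℝ) = e * (r + d) := by push_cast; linarith [hTA]
  have hΔC1 : T - 2 * ((p + l : ℕ) : ℝ) = e * (r + d + 2 * t) := by push_cast; linarith [hTB']
  have hδC2 : ((p + h : ℕ) : ℝ) - ((p + l' : ℕ) : ℝ) = e * 1 := by push_cast; linear_combination -he_def
  have hδC1 : ((p + h : ℕ) : ℝ) - ((p + l : ℕ) : ℝ) = e * (1 + t) := by push_cast; linear_combination -he_def - hte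
  have hδB2 : ((m + l' : ℕ) : ℝ) - ((p + l' : ℕ) : ℝ) = e * w := by push_cast; linear_combination -hwe
  have hδB1 : ((m + l' : ℕ) : ℝ) - ((p + l : ℕ) : ℝ) = e * (w + t) := by push_cast; linear_combination -hwe - hte
  have hδA2 : ((m + l : ℕ) : ℝ) - ((p + l' : ℕ) : ℝ) = e * (w - t) := by push_cast; linear_combination hte - hwe
  have hδA1 : ((m + l : ℕ) : ℝ) - ((p + l : ℕ) : ℝ) = e * w := by push_cast; linear_combination -hwe
  have hm2j : m + l' ≤ j := le_trans hω hPj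
  have hm1j : m + l ≤ j := by omega
  -- availability ↔ scaled compatibility
  have havC2 : (T < ((p + l' : ℕ) : ℝ) + ((p + h : ℕ) : ℝ)) ↔ r + d < 1 := by
    constructor
    · intro hh
      have h1 : e * (r + d) < e * (1) := by linarith [hΔC2, hδC2]
      exact lt_of_mul_lt_mul_left h1 he.le
    · intro hh
      have h1 : e * (r + d) < e * (1) := mul_lt_mul_of_pos_left hh he
      linarith [hΔC2, hδC2]
  have havC1 : (T < ((p + l : ℕ) : ℝ) + ((p + h : ℕ) : ℝ)) ↔ r + d + 2 * t < 1 + t := by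
    constructor
    · intro hh
      have h1 : e * (r + d + 2 * t) < e * (1 + t) := by linarith [hΔC1, hδC1]
      exact lt_of_mul_lt_mul_left h1 he.le
    · intro hh
      have h1 : e * (r + d + 2 * t) < e * (1 + t) := mul_lt_mul_of_pos_left hh he
      linarith [hΔC1, hδC1]
  have havB2 : (T < ((p + l' : ℕ) : ℝ) + ((m + l' : ℕ) : ℝ)) ↔ r + d < w := by
    constructor
    · intro hh
      have h1 : e * (r + d) < e * (w) := by linarith [hΔC2, hδB2]
      exact lt_of_mul_lt_mul_left h1 he.le
    · intro hh
      have h1 : e * (r + d) < e * (w) := mul_lt_mul_of_pos_left hh he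
      linarith [hΔC2, hδB2]
  have havB1 : (T < ((p + l : ℕ) : ℝ) + ((m + l' : ℕ) : ℝ)) ↔ r + d + 2 * t < w + t := by
    constructor
    · intro hh
      have h1 : e * (r + d + 2 * t) < e * (w + t) := by linarith [hΔC1, hδB1]
      exact lt_of_mul_lt_mul_left h1 he.le
    · intro hh
      have h1 : e * (r + d + 2 * t) < e * (w + t) := mul_lt_mul_of_pos_left hh he
      linarith [hΔC1, hδB1]
  have havA2 : (T < ((p + l' : ℕ) : ℝ) + ((m + l : ℕ) : ℝ)) ↔ r + d < w - t := by
    constructor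
    · intro hh
      have h1 : e * (r + d) < e * (w - t) := by linarith [hΔC2, hδA2]
      exact lt_of_mul_lt_mul_left h1 he.le
    · intro hh
      have h1 : e * (r + d) < e * (w - t) := mul_lt_mul_of_pos_left hh he
      linarith [hΔC2, hδA2]
  have havA1 : (T < ((p + l : ℕ) : ℝ) + ((m + l : ℕ) : ℝ)) ↔ r + d + 2 * t < w := by
    constructor
    · intro hh
      have h1 : e * (r + d + 2 * t) < e * (w) := by linarith [hΔC1, hδA1]
      exact lt_of_mul_lt_mul_left h1 he.le
    · intro hh
      have h1 : e * (r + d + 2 * t) < e * (w) := mul_lt_mul_of_pos_left hh he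
      linarith [hΔC1, hδA1]
  -- `e·usage = 1` on every available pair
  have huC2 : r + d < 1 → 0 < usage x T j (p + l') (p + h) ∧ e2P * usage x T j (p + l') (p + h) = 1 := by
    intro hav
    rcases lt_or_ge (r + d) x with hL | hH
    · rw [h2P_L hL]
      have := usage_light_scaled x T e (r + d) 1 j (p + l') (p + h) hx0 hx1 he hPj hΔC2 hδC2 hApos hav (by linarith)
      simpa only [mul_one] using this
    · rw [h2P_H hH hav]
      exact usage_heavy_scaled x T e (r + d) 1 j (p + l') (p + h) hx0 hx1 he hPj hΔC2 hδC2 hApos hav (by linarith)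
  have huC1 : r + d + 2 * t < 1 + t → 0 < usage x T j (p + l) (p + h) ∧ e1P * usage x T j (p + l) (p + h) = 1 := by
    intro hav
    rw [h1P_H hav]
    exact usage_heavy_scaled x T e (r + d + 2 * t) (1 + t) j (p + l) (p + h) hx0 hx1 he hPj hΔC1 hδC1 hBpos hav hxB
  have huB2 : r + d < w → 0 < usage x T j (p + l') (m + l') ∧ e22 * usage x T j (p + l') (m + l') = 1 := by
    intro hav
    rcases lt_or_ge (r + d) (x * w) with hL | hH
    · rw [h22_L hL]
      exact usage_light_scaled x T e (r + d) w j (p + l') (m + l') hx0 hx1 he hm2j hΔC2 hδB2 hApos hav hL.le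
    · rw [h22_H hH hav]
      exact usage_heavy_scaled x T e (r + d) w j (p + l') (m + l') hx0 hx1 he hm2j hΔC2 hδB2 hApos hav hH
  have huB1 : r + d + 2 * t < w + t → 0 < usage x T j (p + l) (m + l') ∧ e12 * usage x T j (p + l) (m + l') = 1 := by
    intro hav
    rw [h12_H hav]
    exact usage_heavy_scaled x T e (r + d + 2 * t) (w + t) j (p + l) (m + l') hx0 hx1 he hm2j hΔC1 hδB1 hBpos hav
      (by have := mul_le_mul_of_nonneg_left (show w + t ≤ 1 + t by linarith) hx0.le; linarith)
  have huA2 : r + d < w - t → 0 < usage x T j (p + l') (m + l) ∧ e21 * usage x T j (p + l') (m + l) = 1 := by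
    intro hav
    rcases lt_or_ge (r + d) (x * (w - t)) with hL | hH
    · rw [h21_L hL]
      exact usage_light_scaled x T e (r + d) (w - t) j (p + l') (m + l) hx0 hx1 he hm1j hΔC2 hδA2 hApos hav hL.le
    · rw [h21_H hH hav]
      exact usage_heavy_scaled x T e (r + d) (w - t) j (p + l') (m + l) hx0 hx1 he hm1j hΔC2 hδA2 hApos hav hH
  have huA1 : r + d + 2 * t < w → 0 < usage x T j (p + l) (m + l) ∧ e11 * usage x T j (p + l) (m + l) = 1 := by
    intro hav
    rw [h11_H hav]
    exact usage_heavy_scaled x T e (r + d + 2 * t) w j (p + l) (m + l) hx0 hx1 he hm1j hΔC1 hδA1 hBpos hav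
      (by have := mul_le_mul_of_nonneg_left (show w ≤ 1 + t by linarith) hx0.le; linarith)
  -- ### masses, pool and the greedy
  have hγ1' : 0 ≤ 1 - (x ^ 2 + (1 - x) * ρc) := by rw [← hγ]; linarith
  have hc1 : 0 ≤ (1 - (x ^ 2 + (1 - x) * ρc)) * (1 - x) * lam := mul_nonneg (mul_nonneg hγ1' (by linarith)) hlam0
  have hc2 : 0 ≤ (1 - (x ^ 2 + (1 - x) * ρc)) * (1 - x) * (1 - lam) := mul_nonneg (mul_nonneg hγ1' (by linarith)) (by linarith)
  have hcP : 0 ≤ (1 - (x ^ 2 + (1 - x) * ρc)) * x := mul_nonneg hγ1' hx0.le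
  have hd1 : 0 ≤ (x ^ 2 + (1 - x) * ρc) * (1 - x) * lam := mul_nonneg (mul_nonneg hγ0.le (by linarith)) hlam0
  have hd2 : 0 ≤ (x ^ 2 + (1 - x) * ρc) * (1 - x) * (1 - lam) := mul_nonneg (mul_nonneg hγ0.le (by linarith)) (by linarith)
  have hdG : 0 ≤ (x ^ 2 + (1 - x) * ρc) * x := mul_nonneg hγ0.le hx0.le
  have hu : 0 < x / (1 - x) := div_pos hx0 (by linarith)
  have hcGu : (x ^ 2 + (1 - x) * ρc) * x / (x / (1 - x)) = (x ^ 2 + (1 - x) * ρc) * (1 - x) := by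
    field_simp
  obtain ⟨F₁A, F₁B, F₁C, R₁, F₂A, F₂B, F₂C, R₂, f1A0, f1B0, f1C0, R10, f2A0, f2B0, f2C0, R20,
      av1A, av1B, av1C, av2A, av2B, av2C, row1, row2, capA, capB, capC, capG⟩ :=
    twoLow_greedy_flows ((1 - (x ^ 2 + (1 - x) * ρc)) * (1 - x) * lam) ((1 - (x ^ 2 + (1 - x) * ρc)) * (1 - x) * (1 - lam)) (x / (1 - x)) ((x ^ 2 + (1 - x) * ρc) * x) ((x ^ 2 + (1 - x) * ρc) * (1 - x) * lam) ((x ^ 2 + (1 - x) * ρc) * (1 - x) * (1 - lam)) ((1 - (x ^ 2 + (1 - x) * ρc)) * x)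
      (usage x T j (p + l) (m + l)) (usage x T j (p + l') (m + l)) (usage x T j (p + l) (m + l')) (usage x T j (p + l') (m + l'))
      (usage x T j (p + l) (p + h)) (usage x T j (p + l') (p + h))
      ((x ^ 2 + (1 - x) * ρc) * (1 - x) * lam * e21) ((x ^ 2 + (1 - x) * ρc) * (1 - x) * (1 - lam) * e12) ((x ^ 2 + (1 - x) * ρc) * (1 - x) * (1 - lam) * e22) ((1 - (x ^ 2 + (1 - x) * ρc)) * x * e1P) ((1 - (x ^ 2 + (1 - x) * ρc)) * x * e2P) κA κB κC
      (T < ((p + l : ℕ) : ℝ) + ((m + l : ℕ) : ℝ)) (T < ((p + l' : ℕ) : ℝ) + ((m + l : ℕ) : ℝ))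
      (T < ((p + l : ℕ) : ℝ) + ((m + l' : ℕ) : ℝ)) (T < ((p + l' : ℕ) : ℝ) + ((m + l' : ℕ) : ℝ))
      (T < ((p + l : ℕ) : ℝ) + ((p + h : ℕ) : ℝ)) (T < ((p + l' : ℕ) : ℝ) + ((p + h : ℕ) : ℝ))
      hc1 hc2 hu hdG hd1 hd2 hcP
      (mul_nonneg hd1 he210) (mul_nonneg hd2 he120) (mul_nonneg hd2 he220) (mul_nonneg hcP he1P0) (mul_nonneg hcP he2P0)
      (fun hav => by obtain ⟨h1, h2⟩ := huA2 (havA2.1 hav); exact ⟨h1, by rw [mul_assoc, h2, mul_one]⟩)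
      (fun hn => by rw [h21_N (not_lt.1 (fun hh => hn (havA2.2 hh))), mul_zero])
      (fun hav => by obtain ⟨h1, h2⟩ := huB1 (havB1.1 hav); exact ⟨h1, by rw [mul_assoc, h2, mul_one]⟩)
      (fun hn => by rw [h12_N (not_lt.1 (fun hh => hn (havB1.2 hh))), mul_zero])
      (fun hav => by obtain ⟨h1, h2⟩ := huB2 (havB2.1 hav); exact ⟨h1, by rw [mul_assoc, h2, mul_one]⟩)
      (fun hn => by rw [h22_N (not_lt.1 (fun hh => hn (havB2.2 hh))), mul_zero])
      (fun hav => by obtain ⟨h1, h2⟩ := huC1 (havC1.1 hav); exact ⟨h1, by rw [mul_assoc, h2, mul_one]⟩)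
      (fun hn => by rw [h1P_N (not_lt.1 (fun hh => hn (havC1.2 hh))), mul_zero])
      (fun hav => by obtain ⟨h1, h2⟩ := huC2 (havC2.1 hav); exact ⟨h1, by rw [mul_assoc, h2, mul_one]⟩)
      (fun hn => by rw [h2P_N (not_lt.1 (fun hh => hn (havC2.2 hh))), mul_zero])
      hκA0
      (fun hav => by
        have h1 := havA1.1 hav
        have h2 : r + d < w - t := by linarith
        obtain ⟨_, u1⟩ := huA1 h1
        obtain ⟨_, u2⟩ := huA2 h2
        have h3 := hκAe h1
        calc κA * usage x T j (p + l) (m + l)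
            = κA * usage x T j (p + l) (m + l) * (e21 * usage x T j (p + l') (m + l)) := by rw [u2, mul_one]
          _ = (κA * e21) * usage x T j (p + l) (m + l) * usage x T j (p + l') (m + l) := by ring
          _ = (e11 * usage x T j (p + l) (m + l)) * usage x T j (p + l') (m + l) := by rw [h3]
          _ = usage x T j (p + l') (m + l) := by rw [u1, one_mul])
      (fun hn => hκA_N (not_lt.1 (fun hh => hn (havA1.2 hh))))
      hκB0
      (fun hav => by
        have h1 := havB1.1 hav
        have h2 : r + d < w := by linarith
        obtain ⟨_, u1⟩ := huB1 h1
        obtain ⟨_, u2⟩ := huB2 h2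
        have h3 := hκBe h1
        calc κB * usage x T j (p + l) (m + l')
            = κB * usage x T j (p + l) (m + l') * (e22 * usage x T j (p + l') (m + l')) := by rw [u2, mul_one]
          _ = (κB * e22) * usage x T j (p + l) (m + l') * usage x T j (p + l') (m + l') := by ring
          _ = (e12 * usage x T j (p + l) (m + l')) * usage x T j (p + l') (m + l') := by rw [h3]
          _ = usage x T j (p + l') (m + l') := by rw [u1, one_mul])
      (fun hn => hκB_N (not_lt.1 (fun hh => hn (havB1.2 hh))))
      hκC0
      (fun hav => by
        have h1 := havC1.1 hav
        have h2 : r + d < 1 := by linarith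
        obtain ⟨_, u1⟩ := huC1 h1
        obtain ⟨_, u2⟩ := huC2 h2
        have h3 := hκCe h1
        calc κC * usage x T j (p + l) (p + h)
            = κC * usage x T j (p + l) (p + h) * (e2P * usage x T j (p + l') (p + h)) := by rw [u2, mul_one]
          _ = (κC * e2P) * usage x T j (p + l) (p + h) * usage x T j (p + l') (p + h) := by ring
          _ = (e1P * usage x T j (p + l) (p + h)) * usage x T j (p + l') (p + h) := by rw [h3]
          _ = usage x T j (p + l') (p + h) := by rw [u1, one_mul])
      (fun hn => hκC_N (not_lt.1 (fun hh => hn (havC1.2 hh))))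
      (fun hav _ => by rw [hcGu]; exact hkA' (havA2.1 hav))
      (fun hav _ _ => by rw [hcGu]; exact hkB' (havB2.1 hav))
      (fun hav _ _ => by rw [hcGu]; exact hkC' (havC2.1 hav))
      (fun _ => by rw [hcGu]; exact hkG')
  -- ### the flow lemma
  have hsum : (1 - (x ^ 2 + (1 - x) * ρc)) * (1 - x) * lam + (1 - (x ^ 2 + (1 - x) * ρc)) * (1 - x) * (1 - lam) + (1 - (x ^ 2 + (1 - x) * ρc)) * x + (x ^ 2 + (1 - x) * ρc) * (1 - x) * lam + (x ^ 2 + (1 - x) * ρc) * (1 - x) * (1 - lam) + (x ^ 2 + (1 - x) * ρc) * x = 1 := by ring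
  have hlow : 2 * ((p : ℝ) + l') < T := by
    have := mul_pos he hApos
    linarith [hTA]
  have hR1 : F₁C + F₁B + F₁A ≤ (1 - (x ^ 2 + (1 - x) * ρc)) * (1 - x) * lam := by linarith
  have hR2 : F₂C + F₂B + F₂A ≤ (1 - (x ^ 2 + (1 - x) * ρc)) * (1 - x) * (1 - lam) := by linarith
  have hcapG' : x / (1 - x) * (((1 - (x ^ 2 + (1 - x) * ρc)) * (1 - x) * lam - F₁C - F₁B - F₁A) + ((1 - (x ^ 2 + (1 - x) * ρc)) * (1 - x) * (1 - lam) - F₂C - F₂B - F₂A)) ≤ (x ^ 2 + (1 - x) * ρc) * x := by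
    have e1 : ((1 - (x ^ 2 + (1 - x) * ρc)) * (1 - x) * lam - F₁C - F₁B - F₁A) + ((1 - (x ^ 2 + (1 - x) * ρc)) * (1 - x) * (1 - lam) - F₂C - F₂B - F₂A) = R₁ + R₂ := by linarith
    rw [e1]; exact capG
  exact lsLaw_decAtT_of_flow x T ((1 - (x ^ 2 + (1 - x) * ρc)) * (1 - x) * lam) ((1 - (x ^ 2 + (1 - x) * ρc)) * (1 - x) * (1 - lam)) ((1 - (x ^ 2 + (1 - x) * ρc)) * x) ((x ^ 2 + (1 - x) * ρc) * (1 - x) * lam) ((x ^ 2 + (1 - x) * ρc) * (1 - x) * (1 - lam)) ((x ^ 2 + (1 - x) * ρc) * x) F₁C F₁B F₁A F₂C F₂B F₂A p m l l' h j M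
    hx0 hx1 hsum hpm hll hlh hlow hM1 hA2 hPj hm2j hGj hGM f1C0 f1B0 f1A0 f2C0 f2B0 f2A0
    av1C av1B av1A av2C av2B av2A hR1 hR2 capC capB capA hcapG'

end LawDec

end Quant

end Summit.CriticalPhenomena.PercolationContinuityZ3.Theorems
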